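import HarnessLib.Audit.LibrarySuggestionsDenyListCorCM
import Summits.HodgeConjecture.CorCM.HypLiu418.A3Liu418GSThmD6OneCurve
import Literature.NumberTheory.Automorphic.Liu2021.AppendixC.ThmD6CompositionGeneric
import Literature.NumberTheory.GaloisRepresentations.CharacterFromFrobeniusPair
import Literature.NumberTheory.Automorphic.FixedDegreeOnePlacesFinite
import Literature.NumberTheory.GaloisRepresentations.HeckeCharacterMuAlgGalConjTwist
import Literature.NumberTheory.GaloisRepresentations.HeckeCharacterInfinityTypeUnique
import Literature.NumberTheory.Automorphic.Liu2021.CheckOfChi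
import Literature.NumberTheory.Automorphic.UnitaryGroupHyperspecialHecke
import Literature.NumberTheory.Automorphic.UnitaryGroupSplitPlaceGelfandPair
import Literature.NumberTheory.Automorphic.Liu2021.AppendixC.EtaleH1TowerCMQuotient
import Literature.AlgebraicGeometry.Motives.AbelianVarietyQuasiIdempotentImageDual
import Literature.RepresentationTheory.Liu2021.OscillatorConventions
import Literature.NumberTheory.ComplexMultiplication.CMInfinityTypeExponentIntrinsic
import Literature.NumberTheory.ComplexMultiplication.RationalInvariantFormsHolds
import Literature.NumberTheory.Automorphic.Liu2021.AppendixC.HeckeEndomorphism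
import Summits.HodgeConjecture.CorCM.HypLiu418.A3Liu418GSConjugateTransport
import Literature.NumberTheory.Automorphic.Liu2021.LemD1SplitPlaceHeckeEigenvaluesChain
import Literature.AlgebraicGeometry.ShimuraVarieties.UnitaryShimuraCurveRecordMorphisms
import Literature.AlgebraicGeometry.ShimuraVarieties.UnitaryShimuraCurveLevelFibres
import Literature.AlgebraicGeometry.Motives.AbelianVarietyEpiTateSurjective
import Literature.NumberTheory.Automorphic.Liu2021.AlbaneseExistence
import Literature.NumberTheory.Automorphic.Liu2021.NablaMapSurjectiveOfPieces
import Literature.NumberTheory.Automorphic.Liu2021.AppendixC.AlbaneseFunctorial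
import Literature.NumberTheory.Automorphic.Liu2021.AppendixC.Sec42DataCompactCase
import Literature.NumberTheory.Automorphic.Liu2021.AppendixC.IsogenyDescentOfLevelQuotientHolds
import Literature.NumberTheory.Automorphic.Liu2021.AppendixC.EtaleHeckeDatumOfTranslates
import HarnessLib
import Literature.AlgebraicGeometry.ComplexMultiplication.TateModuleOfCMDualEigenclass
import Literature.AlgebraicGeometry.ComplexMultiplication.EndFieldCMOfPositiveInvolutionOverSubfield
import Literature.NumberTheory.Automorphic.Liu2021.AppendixC.OmegaHomBlockFieldCharacterLevelwise
import Literature.NumberTheory.Automorphic.Liu2021.AppendixC.EtaleH1SemisimpleOfHeckeImage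
import Literature.NumberTheory.Automorphic.Liu2021.Def411WeilCarriersIrreducibleOrZeroAtLine
import Summits.HodgeConjecture.CorCM.HypLiu418.A3Liu418GSOmegaStarIrreducibleOrZero
import Literature.NumberTheory.Automorphic.Liu2021.AppendixC.OmegaHomIsotypicMultOne
import Literature.NumberTheory.Automorphic.Liu2021.AppendixC.EtaleH1LevelSemisimple
import Literature.NumberTheory.Automorphic.Liu2021.AppendixC.OmegaHomIsotypicComponentLevelwise
import Literature.RingTheory.SimpleModule.SemisimpleBaseChange
import Literature.RingTheory.SimpleModule.BlockFieldCharacter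
import Literature.AlgebraicGeometry.ComplexMultiplication.DualTateComparisonBaseChange
import Literature.LinearAlgebra.BaseChange.SemilinearAutOfIsBaseChange
import Literature.RingTheory.SimpleModule.MultiplicityFreeImageAdjoin
import Literature.RingTheory.SimpleModule.StableSubspacesSemilinearTransport
import Literature.FieldTheory.AlgClosed.AutomorphismExtension
import Literature.NumberTheory.GaloisRepresentations.PadicComplexEmbedding
import Mathlib.RingTheory.Algebraic.Cardinality
import Mathlib.SetTheory.Cardinal.Rat
import Literature.NumberTheory.Automorphic.Liu2021.AppendixC.OmegaHomBlockMultOne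
import Summits.HodgeConjecture.CorCM.HypLiu418.S2primeAssembly
import Literature.RingTheory.Idempotents.CentreBlockFieldOfSemisimple
import Literature.RingTheory.Idempotents.PositiveInvolutionCentreBlockTransport
import Summits.HodgeConjecture.CorCM.HypLiu418.A3Liu418GSOmegaStarSmooth
import Literature.NumberTheory.Automorphic.Liu2021.AppendixC.HeckeImageProjector
import Literature.AlgebraicGeometry.Motives.AbelianVarietySubvarietyQuasiIdempotentImage
import Mathlib.NumberTheory.NumberField.InfinitePlace.Embeddings
import Literature.RingTheory.Idempotents.PositiveInvolutionCentreBlockField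
import Literature.AlgebraicGeometry.Motives.AbelianVarietyImageCornerAction
import Literature.RingTheory.SimpleModule.EndomorphismAlgebraFullRankOneProjector
import Literature.AlgebraicGeometry.Motives.AbelianVarietyQuasiIdempotentImageRank
import Literature.RingTheory.CentralSimple.AlbertTypes
import Literature.NumberTheory.Automorphic.Liu2021.Def411AsPrinted
import Literature.AlgebraicGeometry.ComplexMultiplication.EndomorphismAlgebraBlockModule
import Literature.AlgebraicGeometry.ComplexMultiplication.BlockDimensionIdentityOfTateComparison
import Literature.NumberTheory.Automorphic.Liu2021.AppendixC.OmegaHomBlockFieldCharacter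
import Literature.NumberTheory.Automorphic.Liu2021.AppendixC.OmegaHomBlockProjector

/-!
# `F0D6CmCurveBodyA` — ★ RE-HOME (rung-0 re-homing task, books INVENTORY §8.4 M-3; LEAD F0P6-plan (g4) «M-72») of the crux workfile `Lines/D6CmCurveBodyA.lean`

**SIZE-LINT SPLIT ×5** (`Theorems/` files with proofs are ≤ 400 lines): parts `Theorems/F0D6CmCurveBodyAGlue.lean` → `Theorems/F0D6CmCurveBodyAShapes.lean` → `Theorems/F0D6CmCurveBodyAJunction.lean` → `Theorems/F0D6CmCurveBodyASockets.lean` → `Theorems/F0D6CmCurveBodyA.lean`, each importing the previous, cut at top-level declaration boundaries of `Lines/D6CmCurveBodyA.lean`; namespaces KEPT and re-opened per part (with their `open` lines); the options preamble is repeated verbatim. This is PART 1.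

This `Theorems/` module is the TREE BYTES of `Summits/HodgeConjecture/HodgeConjecture/Cruxes/HLiu418/Lines/D6CmCurveBodyA.lean` (edition of record,
tree sha16 428393244cbb29c7, 1447 l., code-`sorry`-free) with the NAMESPACE KEPT — `Summit.HodgeConjecture.CorCM.Lines.A3Liu418.D6Glue` — so that every
fully-qualified name (`finite_setOf_natCast_mem_asIdeal`, `blockValues`, `GS1`, `GS2`, `GS34`, `gs1_of_pairwise_proportional`, `towerRep_eq_inv_smul_muAlg_of_sockets`, `complexConj_mul_complexConj`, `SocketS1`, `SocketS2`, …; 42 declarations) is UNCHANGED; only this module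
docstring is re-headed.  Why a re-home: a `Theorems/` file cannot import a `Lines/` workfile (F0P6-ref1 o-6), and closing
stmt-HodgeConjecture-24832 `--as proved --by <Theorems decl>` at rung 0 needs the sorry-free Lines chain behind the gate (RE-HOME MAP v1.1, LA7-plan (g4),
2026-09-02; director g27 s1336 (R1)–(R3)).  It has NO `Lines` import (Tier 0).  Lines importers of the original: `D6CmCurveBody`.
After this file is ★ the Lines workfile is meant to become a one-import SHIM of it (a `Lines/` write, batched per cone on the LEAD's word), so no
environment ever holds two copies (NO-CROSS-IMPORT rule, «M-72» (3)).  It asserts nothing beyond what the workfile already proves.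

## Original module docstring (verbatim)
# d6 GLUE PROBE v11 — «v22» = «v21-byimport» + A-p06 (g15) FIX 3 (three `obtain` → `Exists.elim` bodies, the 3 × 3 200 000 budget lines deleted) + the two junction discharges at the DEFAULT budget; «v21-byimport» = «v19» ⧺ Part K⁰ := A-p12 (g9)'s full (P) body (paste, Literature names) ⧺ Part M := §JUNCTION BY IMPORT of ★ `A3Liu418GSConjugateTransport` (K2) + ★ `LemD1SplitPlaceHeckeEigenvaluesChain` (S4): `CMgsm`/`XMgsm`, `k2Shape_holds`, `s4ShapeA_holds`, four-hypothesis head `thmD6OneCurveCUF_of_D9Mop`; «v19» = «v18» with Part K⁰ := A-p12 (g9)'s LITERATURE `honestP5GSM` (unbundled `F`) and `CM`/`XM`/`CorD9OnMOp` binders UNBUNDLED `(F : Type) [Field F] [NumberField F] [IsCMField F]` = the (L)+(P′) SCHEMA junction; «v18» = «v17-D9op» with `C_M`∕`CM` RE-TYPED over A-p13's UNTWISTED `honestP5GSM` (Part K⁰ paste); «v17-D9op» = «v16-K2split» + Part K″ ([D.9 on M⋆] operator-level + intertwiner); «v16-K2split» = «v14-WorldM» + Part K (K2 leg, packaged) +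 Part K′ (K2 leg, SPLIT form [D.9 on M⋆] ∕ K2); «v14-WorldM» VARIANT (A-p15 (g11); A-p13 (g18) 23:49:55Z (F2) / A-plan1 (g13) 23:51:54Z fork): the REGISTERED head
`thmD6OneCurveCUF` (scalar `μ^{alg}`, `_hadm`, S1b AS TYPED, `∃ Sv` first — the TREE def, by import) from v11's texts with EXACTLY two socket
changes: S3 := `S3ShapeM` — Cor. D.9 for print's `M` transported to the tree tower `X = M ⊗_{F,c} F`: Frobenius at `𝔓 ∣ w` pairs with the Hecke
operators at the CONJUGATE place `c • w` (same `w⁺`) —, and S4 := `S4ShapeA` (the ★ chain's labels `((μ^{alg})ᶜ, μ^{alg}χ̌)` at every split place).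
Junction `gs34M_of_local_shapes` reads S4 at `c • w` (★ `valueAtUniformizer_galConj_of_isUnramifiedAt`, ★ `absNorm_algEquiv_smul`) ⇒ GS34 at
★ p747308's REGISTERED pattern `(μ^{alg}, (μ^{alg})ᶜ·η)` with `η := χ̌ᶜ`.  Everything else byte-identical to v11 449e3d3790fa169f.

HOME-only probe (A-p15 (g10), A-plan2 (g11) GO 2026-08-29T20:06:05Z). Nothing here is filed.
HC_CM is proved only modulo the 7 printed citations until rung 0 closes.

For a §4.2 datum `C` (Liu's Albanese tower), an étale Hecke datum `X`, a prime `ℓ`, `ι : ℂ ≃ ℚ̄_ℓ` and ANY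
`ℂ[𝔾(𝔸_F^∞)]`-module `(W, ρW)` («`ω⋆_lab`»), write `Homs := X.omegaHom ι ρW` and `Φ σ := (C.towerRep ℓ σ) ⊗ 1`.
The three GENERIC SOCKETS (hypotheses, not stubs):

* `GS1`  — Γ_E acts on the block of values `{f w | f ∈ Homs}` by scalars (⇐ multiplicity one, S1 clause (1));
* `GS2`  — if the block is non-zero: ONE algebraic Hecke character `ψ` with prescribed first exponent at `w₁` and ONE
  non-zero class `y` in the span of the block on which almost every arithmetic Frobenius acts by `(ι ψ(ϖ_v))⁻¹`
  (= S2′ ∘ ★ `Sec42Data.exists_heckeCharacter_towerRep_eq_inv_smul_of_ringHom′` ∘ (J2));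
* `GS34` — S3 (Eichler–Shimura relation on Hom-values, arithmetic-inverse form `q_v S_v Φ² − T_v Φ + 1 = 0`) ⊕ S4 (Hecke
  eigenvalues `b₁ + b₂`, `b₁ b₂ / q_v`, `b_i = μ_i(ϖ_v)`) ⊕ SM (every vector is spherical at almost every place), over ONE `∃`
  of opaque local data `(Sph, T, S)` (D2/D3 of the card, not yet defined).

Main theorem `towerRep_eq_inv_smul_muAlg_of_sockets`: GS1 → GS2 → GS34 → at EVERY place `v ∤ ℓ` where `μ^{alg}` is
unramified, every arithmetic Frobenius acts on every value of the block by `(ι (μ^{alg}(ϖ_v)))⁻¹` — engines ★ p738679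
(`eq_or_eq_of_valueAtUniformizer_of_dense`), ★ p741460 (`frobenius_dense_smul_ne`), ★ p740290/p739798 pattern (step 4),
★ p740295 (`towerRep_baseChange_eq_inv_smul_of_eventually`, step 5).
-/

noncomputable section

open scoped TensorProduct NumberField
open NumberField IsDedekindDomain Filter
open Literature.NumberTheory.GaloisRepresentations
open Literature.NumberTheory.Automorphic
open Literature.NumberTheory.Automorphic.Liu2021.AppendixC


namespace Summit.HodgeConjecture.CorCM.Lines.A3Liu418.D6Glue

/-! ## Part A (v11) — the generic steps 2–5 are ★ `Literature.NumberTheory.Automorphic.Liu2021.AppendixC.ThmD6CompositionGeneric` (p747308);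
here only the four socket PREDICATES (registry-side names) and thin wrappers keeping the v10 names. -/

open Literature.NumberTheory.Automorphic.Liu2021.AppendixC

variable {F E : Type} [Field F] [NumberField F] [IsTotallyReal F] [Field E] [NumberField E] [Algebra F E]
  [IsTotallyComplex E] [Algebra.IsQuadraticExtension F E]
variable {P5 : PropC5Data F E} {isotropicAt : ℕ → Prop}

/-! **`finite_setOf_natCast_mem_asIdeal` — NOT RESTATED IN THE ★ RE-HOME (gate `dedup.landed`, A-p14 (g39) dry-run 2026-09-02T08:10:53Z):** the Lines original
restates, statement for statement, the already-landed ★ `Literature.NumberTheory.Automorphic.Liu2021.AppendixC.ThmD6Glue.finite_setOf_natCast_mem_asIdeal` (imported above, `ThmD6CompositionGeneric`);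
the ★ re-home uses that declaration BY NAME at every former call site of `finite_setOf_natCast_mem_asIdeal`. -/

section Sockets

variable (C : Sec42Data P5 isotropicAt) (ℓ : ℕ) [Fact ℓ.Prime] (X : C.EtaleHeckeDatum ℓ)
  (ι : ℂ ≃+* AlgebraicClosure ℚ_[ℓ]) {W : Type} [AddCommGroup W] [Module ℂ W] (ρW : Representation ℂ C.G W)

/-- The BLOCK of values `{f w | f ∈ Hom(ι ∘ ω⋆, ℚ̄_ℓ ⊗ H¹_ét), w ∈ ω⋆}` inside `ℚ̄_ℓ ⊗ H¹_ét(A_∞)`. -/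
def blockValues : Set (AlgebraicClosure ℚ_[ℓ] ⊗[ℚ_[ℓ]] C.etaleH1Tower ℓ) :=
  {y | ∃ f ∈ X.omegaHom ι ρW, ∃ w : W, f w = y}

/-- **GS1 (= S1′)** — `Γ_E` acts on the block by scalars: `Φ_σ (f w) = m(σ) • f w`. -/
def GS1 : Prop :=
  ∃ m : Field.absoluteGaloisGroup E → AlgebraicClosure ℚ_[ℓ],
    ∀ σ : Field.absoluteGaloisGroup E, ∀ f ∈ X.omegaHom ι ρW, ∀ w : W,
      (C.towerRep ℓ σ).baseChange (AlgebraicClosure ℚ_[ℓ]) (f w) = m σ • f w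

/-- **GS2 (= S2′ ∘ ★ p739802 ∘ (J2))** — if the block is non-zero: a Hecke character `ψ` of some infinity type `(p, q)`
with `p w₁ = e₁`, and a non-zero class `y` in the span of the block on which almost every arithmetic Frobenius acts by
`(ι ψ(ϖ_v))⁻¹`. -/
def GS2 (w₁ : InfinitePlace E) (e₁ : ℤ) : Prop :=
  (∃ f ∈ X.omegaHom ι ρW, ∃ w : W, f w ≠ 0) →
    ∃ ψ : HeckeCharacter E, (∃ p q : InfinitePlace E → ℤ, ψ.HasInfinityType p q ∧ p w₁ = e₁) ∧
      ∃ y ∈ Submodule.span (AlgebraicClosure ℚ_[ℓ]) (blockValues C ℓ X ι ρW), y ≠ 0 ∧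
        ∀ᶠ v : HeightOneSpectrum (𝓞 E) in cofinite, (ℓ : 𝓞 E) ∉ v.asIdeal →
          ∀ 𝔓 ∈ v.primesAbove, ∀ σ : Field.absoluteGaloisGroup E, IsArithFrobAt (𝓞 E) σ 𝔓 →
            (C.towerRep ℓ σ).baseChange (AlgebraicClosure ℚ_[ℓ]) y = (ι (ψ.valueAtUniformizer v))⁻¹ • y

/-- **GS34 (= SM ⊕ S3 ⊕ S4 over shared opaque local data)** — see ★ `ThmD6CompositionGeneric`. -/
def GS34 (c : E ≃ₐ[F] E) (μ₁ μ₂ : HeckeCharacter E) : Prop :=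
  ∃ (Sph : HeightOneSpectrum (𝓞 E) → Set W) (T S : HeightOneSpectrum (𝓞 E) → (W →ₗ[ℂ] W))
    (S₀ : Set (HeightOneSpectrum (𝓞 E))), S₀.Finite ∧
    (∀ x : W, ∀ᶠ v : HeightOneSpectrum (𝓞 E) in cofinite, x ∈ Sph v) ∧
    (∀ v ∉ S₀, c • v ≠ v → ∀ 𝔓 ∈ v.primesAbove, ∀ σ : Field.absoluteGaloisGroup E, IsArithFrobAt (𝓞 E) σ 𝔓 →
      ∀ f ∈ X.omegaHom ι ρW, ∀ x ∈ Sph v,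
        (Ideal.absNorm v.asIdeal : AlgebraicClosure ℚ_[ℓ]) •
            (C.towerRep ℓ σ).baseChange (AlgebraicClosure ℚ_[ℓ])
              ((C.towerRep ℓ σ).baseChange (AlgebraicClosure ℚ_[ℓ]) (f (S v x))) -
          (C.towerRep ℓ σ).baseChange (AlgebraicClosure ℚ_[ℓ]) (f (T v x)) + f x = 0) ∧
    (∀ v ∉ S₀, c • v ≠ v → ∀ x ∈ Sph v,
      T v x = (μ₁.valueAtUniformizer v + μ₂.valueAtUniformizer v) • x ∧
      (Ideal.absNorm v.asIdeal : ℂ) • S v x = (μ₁.valueAtUniformizer v * μ₂.valueAtUniformizer v) • x)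

/-- `GS1` ⇐ pairwise proportionality (★ p744385 / ★ p747308 `gs1_of_pairwise_proportional`). -/
theorem gs1_of_pairwise_proportional
    (hprop : ∀ f ∈ X.omegaHom ι ρW, ∀ g ∈ X.omegaHom ι ρW, ∃ a : AlgebraicClosure ℚ_[ℓ], g = a • f ∨ f = a • g) :
    GS1 C ℓ X ι ρW :=
  ThmD6Glue.gs1_of_pairwise_proportional C ℓ X ι ρW hprop

end Sockets

section Main

variable [IsCMField E]
variable (C : Sec42Data P5 isotropicAt) (ℓ : ℕ) [Fact ℓ.Prime] (X : C.EtaleHeckeDatum ℓ)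
  (ι : ℂ ≃+* AlgebraicClosure ℚ_[ℓ]) {W : Type} [AddCommGroup W] [Module ℂ W] (ρW : Representation ℂ C.G W)

/-- **STEPS 2–5, generic** = ★ p747308 `ThmD6Glue.towerRep_eq_inv_smul_muAlg_of_sockets` with the socket predicates unfolded. -/
theorem towerRep_eq_inv_smul_muAlg_of_sockets
    {μ : Literature.NumberTheory.Automorphic.IdeleClassGroup E →ₜ* Circle}
    (hμ : IdeleClassGroup.IsConjugateSymplectic E μ) (w₁ : InfinitePlace E)
    (c : E ≃ₐ[F] E) (hc : c ≠ 1) {η : HeckeCharacter E} (hη : η.HasInfinityType (fun _ => 0) (fun _ => 0))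
    (h1 : GS1 C ℓ X ι ρW) (h2 : GS2 C ℓ X ι ρW w₁ ((1 - hμ.infinityType w₁) / 2))
    (h34 : GS34 C ℓ X ι ρW c (IdeleClassGroup.muAlg E μ)
      (HeckeCharacter.galConj (IsCMField.complexConj E) (IdeleClassGroup.muAlg E μ) * η))
    {v : HeightOneSpectrum (𝓞 E)} (hvℓ : (ℓ : 𝓞 E) ∉ v.asIdeal) (hv : (IdeleClassGroup.muAlg E μ).IsUnramifiedAt v)
    {𝔓 : Ideal (absIntegers (𝓞 E) E)} (h𝔓 : 𝔓 ∈ v.primesAbove)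
    {σ : Field.absoluteGaloisGroup E} (hσ : IsArithFrobAt (𝓞 E) σ 𝔓)
    {f : W →ₛₗ[(ι : ℂ →+* AlgebraicClosure ℚ_[ℓ])] AlgebraicClosure ℚ_[ℓ] ⊗[ℚ_[ℓ]] C.etaleH1Tower ℓ}
    (hf : f ∈ X.omegaHom ι ρW) (w : W) :
    (C.towerRep ℓ σ).baseChange (AlgebraicClosure ℚ_[ℓ]) (f w) =
      (ι ((IdeleClassGroup.muAlg E μ).valueAtUniformizer v))⁻¹ • f w :=
  ThmD6Glue.towerRep_eq_inv_smul_muAlg_of_sockets C ℓ X ι ρW hμ w₁ c hc hη h1 h2 h34 hvℓ hv h𝔓 hσ hf w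

end Main

end Summit.HodgeConjecture.CorCM.Lines.A3Liu418.D6Glue

open scoped TensorProduct Matrix NumberField Kronecker ComplexOrder
open NumberField NumberField.InfinitePlace IsDedekindDomain
open Summit.HodgeConjecture.CorCM.Model Summit.HodgeConjecture.CorCM.Model.HComp Summit.HodgeConjecture.CorCM.HComp
open Literature.AlgebraicGeometry.Motives (CMType)
open Literature.AlgebraicGeometry.ShimuraVarieties.UnitaryCanonicalModel
open Literature.NumberTheory.Automorphic Literature.NumberTheory.Automorphic.UnitaryGroup
open Literature.NumberTheory.Automorphic.IdeleClassGroup Literature.NumberTheory.Automorphic.Liu2021 Literature.NumberTheory.Automorphic.Liu2021.AppendixC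
open Literature.NumberTheory.GaloisRepresentations Literature.RepresentationTheory.Liu2021 Literature.RepresentationTheory.HarrisKudlaSweet1996
open Literature.AlgebraicGeometry.Liu2021 (IsAdmissibleElement)
open Literature.NumberTheory.Weil1964 Literature.NumberTheory.GelbartRogawski1991 Literature.NumberTheory.GelbartRogawski1991.UnitaryDualPair Literature.NumberTheory.GelbartRogawski1991.UnitaryDualPair.WeilCoinv
open Literature.NumberTheory.GelbartRogawski1991.UnitaryDualPair.LocalSplitting
open Literature.NumberTheory.Automorphic.Liu2021.Def411WeilCarriersDoubling
open Literature.NumberTheory.Automorphic.Liu2021.Def411WeilCarriers (TW JW JW_eq isSymm_TW isUnit_det_TW Rep Eps epsOf Chi rhoVAtLine)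

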